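import Summits.Parity.GeneralizedHardyLittlewood.Theorems.GreenTaoLevelTwoGITwoCyclicInverseDescent
import Summits.Parity.GeneralizedHardyLittlewood.Theorems.GreenTaoLevelTwoGITwoCyclicInverseTranslateAverage
import Summits.Parity.GeneralizedHardyLittlewood.Theorems.GreenTaoLevelTwoGITwoCyclicInversePhaseReplaceFamily

/-!
# Route `GreenTaoLevelTwo`, crux `GITwo` (stmt-Parity-21275), line `birth`, stub `stub_cyclicInverse`:
# C13 assembly, step 4: descent + translates + phase replacement chained (GT08a §9 Step 3)

Eighty-second helper file toward the XL stub `stub_cyclicInverse` (B. Green, T. Tao, *An inverse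
theorem for the Gowers `U³(G)` norm*, arXiv:math/0503014, Thm. 68 = PEMS 51 (2008) Thm. 12.8).
Block C13 (§9 Step 3, from (eq9.72) to "Thus we have `𝔼_y|𝔼_{x,h∈B₄} b(h,y)b(x+h,y)f̄(x+y)e(Mx·x)|
≥ 2^{-C₄-2}η^{C'₄}`"): the three landed steps `exists_descent`, `exists_translate_family_ge`,
`sum_norm_phase_replaced_ge` chained for an abstract small set `A = B₄` (its smallness, the
additivity of `μ` on `A + B₁` and on `A + A`, and the bound on the antisymmetric form on `A × A`
being hypotheses — discharged for `A = B(S ∪ F ∪ c·S ∪ {1}, ρ₄)` by `…SmallBohr`).  Def-free: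

* `exists_phase_replaced_family` — `∃ h' ∈ B₁, ∃ b` (`1`-bounded) with
  `(κ/2 − 2πθ) N #A² ≤ Σ_y |Σ_{h∈A} b'(y,h) Σ_{x∈A} c₂'(x+y+h) conj e(cμ(x+h)(x+h)) (c₃'(x+y) e(cμ(x)x))|`,
  `c₂' = b₂(· + h')`, `c₃' = b₃ · e(−μ(h')·)`, `b'(y,h) = b(y,h)e(cμ(h)h)`.

References: [GreenTao2008U3Inverse] arXiv:math/0503014, §9 Step 3.
-/

noncomputable section

namespace Summit.Parity.GeneralizedHardyLittlewood.GreenTaoLevelTwoGITwoCyclicInverse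

open Finset ZMod
open scoped ComplexConjugate
open Literature.NumberTheory.Sieve

variable {N : ℕ} [NeZero N]

/-- **§9 Step 3 chained (descent, translates, phase replacement).**  See the module docstring; the
output is the `y`-family of localized quadratic-phase correlations on the small set `A`.
[cite: GreenTao2008U3Inverse, §9 Step 3] -/
theorem exists_phase_replaced_family (S : Finset (ZMod N)) (hS : S.Nonempty) {ρ₁ ε κ θ : ℝ}
    (hρ₁ : 0 < ρ₁) (hε0 : 0 < ε) (hε100 : ε ≤ 1 / (100 * (#S : ℝ)))
    (hκε : 200 * (#S : ℝ) * ε ≤ κ / 2)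
    (hreg : ∀ r : ℝ, |r| ≤ 1 / (100 * (#S : ℝ)) →
      (1 - 100 * (#S : ℝ) * |r|) * #{x : ZMod N | ∀ ξ ∈ S, ‖ZMod.toAddCircle (x * ξ)‖ < ρ₁} ≤
          #{x : ZMod N | ∀ ξ ∈ S, ‖ZMod.toAddCircle (x * ξ)‖ < (1 + r) * ρ₁} ∧
        (#{x : ZMod N | ∀ ξ ∈ S, ‖ZMod.toAddCircle (x * ξ)‖ < (1 + r) * ρ₁} : ℝ) ≤
          (1 + 100 * (#S : ℝ) * |r|) * #{x : ZMod N | ∀ ξ ∈ S, ‖ZMod.toAddCircle (x * ξ)‖ < ρ₁})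
    {A : Finset (ZMod N)} (hA : ∀ a ∈ A, ∀ ξ ∈ S, ‖ZMod.toAddCircle (a * ξ)‖ ≤ ε * ρ₁)
    {μ : ZMod N → ZMod N}
    (hadd : ∀ a ∈ A, ∀ h' ∈ ({x : ZMod N | ∀ ξ ∈ S, ‖ZMod.toAddCircle (x * ξ)‖ < ρ₁} :
      Finset (ZMod N)), μ (a + h') = μ a + μ h')
    (haddA : ∀ x ∈ A, ∀ h ∈ A, μ (x + h) = μ x + μ h) {c : ZMod N} (hc : 2 * c = 1)
    (hθ : ∀ x ∈ A, ∀ h ∈ A, ‖ZMod.toAddCircle (c * μ x * h - c * μ h * x)‖ ≤ θ)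
    (b₂ b₃ : ZMod N → ℂ) (hb₂ : ∀ x, ‖b₂ x‖ ≤ 1) (hb₃ : ∀ x, ‖b₃ x‖ ≤ 1)
    (hbig : κ * N * #{x : ZMod N | ∀ ξ ∈ S, ‖ZMod.toAddCircle (x * ξ)‖ < ρ₁} ≤
      ∑ h ∈ ({x : ZMod N | ∀ ξ ∈ S, ‖ZMod.toAddCircle (x * ξ)‖ < ρ₁} : Finset (ZMod N)),
        ‖∑ x : ZMod N, b₂ (x + h) * b₃ x * stdAddChar (-(μ h * x))‖) :
    ∃ h' ∈ ({x : ZMod N | ∀ ξ ∈ S, ‖ZMod.toAddCircle (x * ξ)‖ < ρ₁} : Finset (ZMod N)),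
      ∃ b : ZMod N → ZMod N → ℂ, (∀ y h, ‖b y h‖ ≤ 1) ∧
        κ / 2 * N * (#A : ℝ) ^ 2 - 2 * Real.pi * θ * N * (#A : ℝ) ^ 2 ≤
          ∑ y : ZMod N, ‖∑ h ∈ A, (b y h * stdAddChar (c * μ h * h)) *
            ∑ x ∈ A, (b₂ (x + y + h + h') * conj (ZMod.stdAddChar (c * μ (x + h) * (x + h)) : ℂ)) *
              ((b₃ (x + y) * stdAddChar (-(μ h' * (x + y)))) * stdAddChar (c * μ x * x))‖ := by
  classical
  -- Step A: descent to `A`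
  obtain ⟨h', hh', hdesc⟩ := exists_descent S hS hρ₁ hε0 hε100 hκε hreg hA hadd b₂ b₃ hb₂ hb₃ hbig
  refine ⟨h', hh', ?_⟩
  -- the translated weights
  set c₂' : ZMod N → ℂ := fun v => b₂ (v + h') with hc₂'
  set c₃' : ZMod N → ℂ := fun v => b₃ v * stdAddChar (-(μ h' * v)) with hc₃'
  have hc₂'1 : ∀ v, ‖c₂' v‖ ≤ 1 := fun v => hb₂ _
  have hc₃'1 : ∀ v, ‖c₃' v‖ ≤ 1 := fun v => by
    rw [hc₃']; simp only
    rw [norm_mul, norm_stdAddChar, mul_one]; exact hb₃ v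
  -- rewrite the descent output in the translate lemma's input shape
  have hbig' : κ / 2 * N * #A ≤
      ∑ h ∈ A, ‖∑ x : ZMod N, c₂' (x + h) * c₃' x * stdAddChar (-(μ h * x))‖ := by
    refine hdesc.trans (le_of_eq ?_)
    refine Finset.sum_congr rfl fun a _ => ?_
    congr 1
    refine Finset.sum_congr rfl fun x _ => ?_
    rw [hc₂', hc₃']
    simp only
    rw [add_right_comm x h' a]
  -- Step B: translates
  obtain ⟨b, hb, htrans⟩ := exists_translate_family_ge A μ c₂' c₃' hbig'
  refine ⟨b, hb, ?_⟩
  -- Step C: phase replacement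
  have hrepl := sum_norm_phase_replaced_ge A hc μ haddA hθ b c₂' c₃' hb hc₂'1 hc₃'1 htrans
  exact hrepl

end Summit.Parity.GeneralizedHardyLittlewood.GreenTaoLevelTwoGITwoCyclicInverse
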